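import Mathlib
import Literature.AlgebraicGeometry.RelativeSpec.GeometricQuotientFreeTorsor
import Literature.AlgebraicGeometry.RelativeSpec.GeometricQuotientEtaleOnFreeLocus
import Literature.AlgebraicGeometry.RelativeSpec.FreeActionOfPoints
import Literature.AlgebraicGeometry.RelativeSpec.FiniteGroupQuotientGluing
import Literature.AlgebraicGeometry.Ramification.InertiaNormalSylowBaseChange
import Summits.ResolutionOfSingularities.ResolutionOfSingularities.Theorems.WildQuotientsWildQuotientResolutionEtaleLocusInertia
import HarnessLib

/-!
# A finite geometric quotient is a Galois torsor over its free (= étale) locus, in Abbes–Saito's format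
# (crux `WildQuotients.WildQuotientResolution`, Phase 0 — step R1 of the reduction to AS2011 Prop. 2.22)

Crux stmt-ResolutionOfSingularities-15640 (`WildQuotientResolution`), line `Sketch`, registered stub
`stub_phaseZeroHighDim`. The inertia half of Phase 0 is Abbes–Saito 2011, Prop. 2.22, typed in the tree as
the named fact `AbbesSaito2011_inertiaNormalSylow_after_admissibleBlowup`, whose input is a GALOIS TORSOR
`V → U ⊆ X` in the precise shape `Ramification.IsGaloisTorsor f U ρ` (AS2011 2.3: `G` acts over `X`,
`f : V → X` étale with image exactly `U`, and the action map `∐_G V → V ×_X V` an isomorphism). This file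
produces that input from the line's quotient data:

* `isGaloisTorsor_restrict_of_free` — for an AFFINE GEOMETRIC QUOTIENT `p : X → Q` of a finite group
  action (`RelativeSpec.ActionOver.IsGeometricQuotient`, Mumford §7 (1)(2); the line's quotient
  `X′ → X′/G` of ✓`stub_quotientModel` is one) and an open `W ⊆ Q` over which the action is FREE on
  field-valued points, the restricted action on `p⁻¹W` makes `p⁻¹W → Q` a Galois torsor over `W`:
  étale by the tree's ★`etale_morphismRestrict_of_forall_comp_aut_ne` (SGA 1 V 2.6), image `W`
  (`p` surjective), and the action map an isomorphism by the tree's ★`isIso_sigmaDesc_graph_of_free`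
  (`∐_G V ⥲ V ×_W V`, the graphs of a free quotient) transported along `V ×_W V ≅ V ×_Q V` (`W ↪ Q` is a
  monomorphism, Mathlib `pullbackIsPullbackOfCompMono`) and the symmetry `(1, g) ↦ (g, 1)`.
* `isGaloisTorsor_restrict_of_etale` — for a FAITHFUL action on an INTEGRAL `X` with `p` separated,
  the free locus contains the étale locus (✓`EtaleLocusInertia.inertiaSubgroup_eq_bot_of_etale` +
  `mem_inertiaSubgroup_iff_comp_eq`): `p⁻¹W → Q` is a Galois torsor over every open `W` with
  `Etale (p ∣_ W)`.

With ✓`IsGaloisTorsor.exists_admissibleBlowup` this feeds the named fact: Phase 0 with "`Xs` NORMAL"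
(instead of regular) is AS2011 2.22 + this file + the normalisation glue (memo PHASE0-AS2011-v2.md on the
item, census R1/R2); the regularity clause is the open residual (R3).

[OURS · crux stmt-ResolutionOfSingularities-15640 · helper toward `stub_phaseZeroHighDim`; folklore
(SGA 1 V 2.6–2.8), counted 0; AI-level work, weaker than expert review.]
-/

-- single-problem summit: the doubled namespace component `ResolutionOfSingularities` is forced
set_option linter.dupNamespace false

noncomputable section

universe u

open CategoryTheory CategoryTheory.Limits AlgebraicGeometry TopologicalSpace
open Literature.AlgebraicGeometry.Ramification Literature.AlgebraicGeometry.RelativeSpec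
open Literature.AlgebraicGeometry.Resolution

namespace Summit.ResolutionOfSingularities.ResolutionOfSingularities.Theorems.WildQuotientResolution.GaloisTorsorFreeLocus

set_option backward.isDefEq.respectTransparency false

variable {G : Type u} [Group G]

/-- **The action map as a cofan followed by a comparison map**: if `γ g ≫ e` has components
`(σ g, 𝟙)` for every `g` (`e : P → V ×_S V` any morphism, e.g. the comparison `V ×_W V ≅ V ×_S V`
followed by the symmetry of the fibre square, `γ g` the graphs `(𝟙, σ g)`), then Abbes–Saito's action
map `∐_G V → V ×_S V`, `(g, v) ↦ (g·v, v)`, equals `Sigma.desc γ ≫ e`. [folklore] -/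
theorem actionMap_eq_desc_comp {V S : Scheme.{u}} (f : V ⟶ S) (σ : G →* Aut V)
    (hσ : ∀ g : G, (σ g).hom ≫ f = f) {P : Scheme.{u}} (e : P ⟶ pullback f f)
    (γ : G → (V ⟶ P)) (hγ₁ : ∀ g, γ g ≫ e ≫ pullback.fst f f = (σ g).hom)
    (hγ₂ : ∀ g, γ g ≫ e ≫ pullback.snd f f = 𝟙 V) :
    actionMap f σ hσ = Sigma.desc γ ≫ e := by
  apply Sigma.hom_ext
  intro g
  rw [ι_actionMap, Sigma.ι_desc_assoc]
  apply pullback.hom_ext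
  · rw [pullback.lift_fst, Category.assoc, hγ₁]
  · rw [pullback.lift_snd, Category.assoc, hγ₂]

/-- **A free affine geometric quotient is a Galois torsor over the free locus (AS2011 2.3 format).**
Let `p : X → Q` be an affine geometric quotient of the action `ρ` of the finite group `G`
(Mumford §7 (1)(2)), and `W ⊆ Q` an open over which `G` acts FREELY on field-valued points: no `g ≠ 1`
fixes an `Ω`-point of `p⁻¹W`, `Ω` any field. Then, for the restricted action on `V = p⁻¹W`, the map
`V → Q` (`= p|_W ≫ (W ↪ Q)`) is a Galois torsor over `W`: étale (SGA 1 V 2.6, tree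
★`etale_morphismRestrict_of_forall_comp_aut_ne`), with image `W`, and action map `∐_G V ⥲ V ×_Q V`
(tree ★`isIso_sigmaDesc_graph_of_free` over `W`, transported along the monomorphism `W ↪ Q`).
[cite: SGA1, Exp. V Prop. 2.6, 2.8] [cite: AbbesSaito2011, 2.3] -/
theorem isGaloisTorsor_restrict_of_free {X Y : Scheme.{u}} {r : X ⟶ Y} [Fintype G] {ρ : ActionOver r G}
    {Q : Scheme.{u}} {p : X ⟶ Q} [IsAffineHom p] (hq : ρ.IsGeometricQuotient p) (W : Q.Opens)
    (hfree : ∀ (Ω : Type u) [Field Ω] (x : Spec (.of Ω) ⟶ (p ⁻¹ᵁ W : Scheme.{u})) (g : G), g ≠ 1 →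
      (x ≫ (p ⁻¹ᵁ W).ι) ≫ (ρ.aut g).hom ≠ x ≫ (p ⁻¹ᵁ W).ι) :
    IsGaloisTorsor ((p ∣_ W) ≫ W.ι) W (ρ.restrict (p ⁻¹ᵁ W) (hq.preimage_stable W)).aut := by
  haveI : IsAffineHom (p ∣_ W) := IsZariskiLocalAtTarget.restrict ‹IsAffineHom p› W
  -- the restricted action and quotient over `W`, rebased over `p|_W`
  have h1 := hq.restrict W
  set ρW := ρ.restrict (p ⁻¹ᵁ W) (hq.preimage_stable W) with hρW
  have hι : ∀ g : G, (ρW.aut g).hom ≫ (p ⁻¹ᵁ W).ι = (p ⁻¹ᵁ W).ι ≫ (ρ.aut g).hom := fun g => by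
    rw [hρW, ActionOver.restrict_aut_hom, ActionOver.restrictHom_ι]
  let ρW' : ActionOver (p ∣_ W) G := ⟨ρW.aut, h1.comp_eq⟩
  have h2 : ρW'.IsGeometricQuotient (p ∣_ W) :=
    (ρW.isGeometricQuotient_overMap_iff (p ∣_ W) h1.comp_eq (p ∣_ W)).mpr h1
  -- freeness: on geometric points (for étaleness) and on the affine charts (for the graphs)
  have hpt : ∀ (Ω : Type u) [Field Ω] [IsAlgClosed Ω] (x : Spec (.of Ω) ⟶ (p ⁻¹ᵁ W : Scheme.{u}))
      (g : G), g ≠ 1 → x ≫ (ρW'.aut g).hom ≠ x := by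
    intro Ω _ _ x g hg hx
    refine hfree Ω x g hg ?_
    rw [Category.assoc, ← hι g, ← Category.assoc]
    exact congrArg (· ≫ (p ⁻¹ᵁ W).ι) hx
  have hfreeW := ρW'.free_of_forall_comp_aut_ne hpt
  have hcomp : ∀ g : G, (ρW.aut g).hom ≫ (p ∣_ W) ≫ W.ι = (p ∣_ W) ≫ W.ι := fun g => by
    rw [← Category.assoc, h1.comp_eq]
  refine ⟨hcomp, ?_, ?_, ?_⟩
  · -- étale
    haveI : Etale (p ∣_ W) :=
      hq.etale_morphismRestrict_of_forall_comp_aut_ne W fun Ω _ _ x g hg => hfree Ω x g hg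
    infer_instance
  · -- image `W`
    rw [Scheme.Hom.comp_base, TopCat.coe_comp, Set.range_comp, h1.surjective.range_eq, Set.image_univ,
      Scheme.Opens.range_ι]
  · -- the action map is an isomorphism: graphs over `W`, transported along `W ↪ Q`, then swapped
    have hiso := h2.isIso_sigmaDesc_graph_of_free hfreeW
    -- `V ×_W V ≅ V ×_Q V`
    let eW : pullback (p ∣_ W) (p ∣_ W) ≅ pullback ((p ∣_ W) ≫ W.ι) ((p ∣_ W) ≫ W.ι) :=
      (pullbackIsPullbackOfCompMono (p ∣_ W) (p ∣_ W) W.ι).conePointUniqueUpToIso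
        (limit.isLimit (cospan ((p ∣_ W) ≫ W.ι) ((p ∣_ W) ≫ W.ι)))
    have heW₁ : eW.hom ≫ pullback.fst ((p ∣_ W) ≫ W.ι) ((p ∣_ W) ≫ W.ι) = pullback.fst (p ∣_ W) (p ∣_ W) :=
      IsLimit.conePointUniqueUpToIso_hom_comp _ _ WalkingCospan.left
    have heW₂ : eW.hom ≫ pullback.snd ((p ∣_ W) ≫ W.ι) ((p ∣_ W) ≫ W.ι) = pullback.snd (p ∣_ W) (p ∣_ W) :=
      IsLimit.conePointUniqueUpToIso_hom_comp _ _ WalkingCospan.right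
    have heq := actionMap_eq_desc_comp ((p ∣_ W) ≫ W.ι) ρW.aut hcomp
      (eW.hom ≫ (pullbackSymmetry ((p ∣_ W) ≫ W.ι) ((p ∣_ W) ≫ W.ι)).hom)
      (fun g : G => (pullback.lift (𝟙 _) (ρW'.aut g).hom (by rw [Category.id_comp, h2.comp_eq]) :
        (p ⁻¹ᵁ W : Scheme.{u}) ⟶ pullback (p ∣_ W) (p ∣_ W)))
      (fun g => by
        rw [Category.assoc, pullbackSymmetry_hom_comp_fst, heW₂, pullback.lift_snd])
      (fun g => by
        rw [Category.assoc, pullbackSymmetry_hom_comp_snd, heW₁, pullback.lift_fst])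
    rw [heq]
    infer_instance

/-- **A geometric quotient of an integral scheme by a faithful finite group is a Galois torsor over
its étale locus.** If moreover `X` is integral, `p` separated and the action faithful, then over every
open `W ⊆ Q` with `p|_W` étale the action is free on field-valued points — an `Ω`-point of `p⁻¹W` fixed
by `g` puts `g` in the inertia group of its image (`mem_inertiaSubgroup_iff_comp_eq`), which is
trivial over the étale locus (✓`EtaleLocusInertia.inertiaSubgroup_eq_bot_of_etale`) — so
`isGaloisTorsor_restrict_of_free` applies: `p⁻¹W → Q` is a Galois torsor over `W` in the sense of
AS2011 2.3, the input of the named fact AS2011 Prop. 2.22. (Universe `0`, where the crux lives.)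
[cite: SGA1, Exp. V Prop. 2.6, Cor. 2.4] [cite: AbbesSaito2011, 2.3, Prop. 2.22] -/
theorem isGaloisTorsor_restrict_of_etale {G : Type} [Group G] [Fintype G] {X Y : Scheme.{0}}
    {r : X ⟶ Y} {ρ : ActionOver r G} {Q : Scheme.{0}} {p : X ⟶ Q} [IsAffineHom p] [IsIntegral X]
    (hq : ρ.IsGeometricQuotient p) (hfaith : Function.Injective ρ.aut) (W : Q.Opens)
    [Etale (p ∣_ W)] :
    IsGaloisTorsor ((p ∣_ W) ≫ W.ι) W (ρ.restrict (p ⁻¹ᵁ W) (hq.preimage_stable W)).aut := by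
  haveI : IsSeparated p := inferInstance
  refine isGaloisTorsor_restrict_of_free hq W fun Ω _ x g hg hx => hg ?_
  have hmem : g ∈ inertiaSubgroup ρ.aut ((x ≫ (p ⁻¹ᵁ W).ι) (IsLocalRing.closedPoint Ω)) :=
    (mem_inertiaSubgroup_iff_comp_eq ρ.aut (x ≫ (p ⁻¹ᵁ W).ι) g).mpr hx
  have hW : p (((x ≫ (p ⁻¹ᵁ W).ι) (IsLocalRing.closedPoint Ω))) ∈ W := by
    rw [Scheme.Hom.comp_apply, Scheme.Opens.ι_apply]
    exact (x (IsLocalRing.closedPoint Ω)).2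
  rw [EtaleLocusInertia.inertiaSubgroup_eq_bot_of_etale p ρ.aut hfaith hq.comp_eq W _ hW] at hmem
  exact Subgroup.mem_bot.mp hmem

/-- **Phase 0′ over the quotient, conditional on AS2011 Prop. 2.22 (the typed named fact).** For the
crux's shape of data — a faithful finite group `G` acting on an integral `X` with affine geometric
quotient `p : X → Q`, `Q` NORMAL and locally of finite type over a field of characteristic `ℓ`, and a
DENSE open `W ⊆ Q` over which `p` is étale — Abbes–Saito's (NS4) applies to the Galois torsor
`p⁻¹W → W` (`isGaloisTorsor_restrict_of_etale`): there is a `W`-admissible blow-up `φ : Q′ → Q` (a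
blowing up in a finite-type ideal with support off `W`) and the lift `f′ : p⁻¹W → Q′` such that EVERY
inertia group of `G` on the integral closure of `Q′` in `p⁻¹W` (Mathlib's relative normalisation
`f′.normalization`, with the induced action `normalizationAction`) has a normal Sylow `ℓ`-subgroup. This
is "Phase 0 with a NORMAL model" for the line `Sketch`, conditional on the named fact only; the
registered stub asks for a REGULAR model (census R3). [cite: AbbesSaito2011, Prop. 2.22 (NS4), 2.3, Def. 2.12] -/
theorem exists_admissibleBlowup_forall_hasNormalSylow
    (hAS : AbbesSaito2011_inertiaNormalSylow_after_admissibleBlowup.{0})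
    {ℓ : ℕ} [Fact ℓ.Prime] {k : Type} [Field k] [CharP k ℓ]
    {G : Type} [Group G] [Fintype G] {X Y : Scheme.{0}} {r : X ⟶ Y} {ρ : ActionOver r G}
    {Q : Scheme.{0}} {p : X ⟶ Q} [IsAffineHom p] [IsIntegral X]
    (hq : ρ.IsGeometricQuotient p) (hfaith : Function.Injective ρ.aut) (W : Q.Opens) [Etale (p ∣_ W)]
    (sQ : Q ⟶ Spec (.of k)) (hft : LocallyOfFiniteType sQ)
    (hN : ∀ y : Q, IsDomain (Q.presheaf.stalk y) ∧ IsIntegrallyClosed (Q.presheaf.stalk y))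
    (hW : Dense (W : Set Q)) :
    ∃ (Q' : Scheme.{0}) (φ : Q' ⟶ Q) (I : Q.IdealSheafData),
      IsBlowup φ I ∧ (∀ U : Q.affineOpens, (I.ideal U).FG) ∧ Disjoint (W : Set Q) (I.support : Set Q) ∧
      ∃ (f' : (p ⁻¹ᵁ W : Scheme.{0}) ⟶ Q') (_ : QuasiCompact f') (_ : QuasiSeparated f')
        (hρ' : ∀ g, ((ρ.restrict (p ⁻¹ᵁ W) (hq.preimage_stable W)).aut g).hom ≫ f' = f'),
        f' ≫ φ = (p ∣_ W) ≫ W.ι ∧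
          ∀ y : ↥f'.normalization, HasNormalSylow ℓ
            (inertiaSubgroup (normalizationAction f' (ρ.restrict (p ⁻¹ᵁ W) (hq.preimage_stable W)).aut hρ') y) := by
  obtain ⟨Q', φ, I, hb, hfg, hdisj, f', hqc, hqs, hρ', hf', hN'⟩ :=
    (isGaloisTorsor_restrict_of_etale hq hfaith W).exists_admissibleBlowup hAS hft hN hW
  exact ⟨Q', φ, I, hb, hfg, hdisj, f', hqc, hqs, hρ', hf', inertiaNormalSylow_iff_forall.mp hN'⟩

end Summit.ResolutionOfSingularities.ResolutionOfSingularities.Theorems.WildQuotientResolution.GaloisTorsorFreeLocus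

end
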